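import Mathlib
import HarnessLib
import Literature.NumberTheory.LFunctions.RiemannXi

/-!
# The Mellin transforms of the pole-killed Hermite seeds and Riemann's `ξ`

Helper file (`--supports stmt-RiemannHypothesis-0098`), RH-free complex analysis (Gaussian Mellin moments, `Γ`
recursion, the definition of `ξ`), no definitions.  Seat rh-explicit-weil-5 gen15 (file of record
`HOME/rh-explicit-weil-5/WEIL5-KAPPA.md` §1).

Context (documentation only).  In the Hermite limit `c → ∞` the two class seeds of the compressed Weil form are the
POLE-KILLED Hermite combinations `h_e = h₄ − √(3/8) h₀ = κ_e·y²(y² − 3)e^{−y²/2}` (even sector; Connes–Consani–Moscovici's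
`h`, arXiv:2511.22755 (7.4)) and `h_o = h₆ − √(5/8) h₂ = κ_o·y²(y⁴ − (15/2)y² + 15/2)e^{−y²/2}` (odd sector), `κ_e = 2/(√6 π^{1/4})`,
`κ_o = 2/(3√5 π^{1/4})`.  Their Mellin transforms `M_h(s) = ∫₀^∞ h(y) y^{s−1} dy` factor through `s(s−1)` — the pole
constraint — and multiply `ζ` into Riemann's `ξ`:

* `mellin_gaussian`            : `∫_{(0,∞)} y^{s−1} e^{−y²/2} dy = 2^{s/2−1} Γ(s/2)` (`Re s > 0`);
* `mellin_gaussian_mul_pow`    : the same with an extra `y^{2k}`: `2^{(s+2k)/2−1} Γ((s+2k)/2)`;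
* `hermiteSeedEven_mellin`     : `∫ y^{s−1}(y⁴ − 3y²)e^{−y²/2} = 2^{s/2−1}Γ(s/2)·s(s−1)`;
* `hermiteSeedOdd_mellin`      : `∫ y^{s−1}(y⁶ − (15/2)y⁴ + (15/2)y²)e^{−y²/2} = 2^{s/2−1}Γ(s/2)·s(s−1)(s − 1/2)`;
* `zeta_mul_evenFactor`        : `ζ(s)·2^{s/2−1}Γ(s/2)s(s−1) = (2π)^{s/2} ξ(s)` (`Re s > 0`, `s ≠ 1`), and the odd twin;
* `norm_zeta_mul_evenFactor_critical` : on the critical line `‖ζ·M_e‖ = (2π)^{1/4}‖Ξ(γ)‖` (`Ξ = riemannXiUpper`).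

With Mellin–Plancherel these give the transport Gram norms of WEIL5-KAPPA §1: `‖𝓔h_e‖² ∝ ∫Ξ²`, `‖𝓔h_o‖² ∝ ∫t²Ξ²`.
Standard axioms only; no `sorry`.
-/

set_option linter.dupNamespace false
set_option autoImplicit false

noncomputable section

open Real MeasureTheory Set Complex

namespace Summit.RiemannHypothesis.RiemannHypothesis.Theorems.WeilHermiteSeedMellin

/-- For `0 < y`: `y · (y²)^{s/2 − 1} = y^{s − 1}` (complex powers of a positive real base). -/
theorem ofReal_mul_sq_cpow {y : ℝ} (hy : 0 < y) (s : ℂ) :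
    (y : ℂ) * (((y ^ (2 : ℝ) : ℝ) : ℂ)) ^ (s / 2 - 1) = (y : ℂ) ^ (s - 1) := by
  have hy0 : (y : ℂ) ≠ 0 := ofReal_ne_zero.mpr hy.ne'
  have h2 : (((y ^ (2 : ℝ) : ℝ) : ℂ)) = (y : ℂ) ^ (2 : ℂ) := by
    rw [ofReal_cpow hy.le]
    norm_num
  have hlog : (Complex.log (y : ℂ) * 2).im = 0 := by
    rw [← ofReal_log hy.le]
    norm_cast
  have h1 : -π < (Complex.log (y : ℂ) * 2).im := by rw [hlog]; exact neg_neg_of_pos pi_pos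
  have h1' : (Complex.log (y : ℂ) * 2).im ≤ π := by rw [hlog]; exact pi_pos.le
  rw [h2, ← cpow_mul (s / 2 - 1) h1 h1']
  calc (y : ℂ) * (y : ℂ) ^ (2 * (s / 2 - 1))
      = (y : ℂ) ^ (1 : ℂ) * (y : ℂ) ^ (2 * (s / 2 - 1)) := by rw [cpow_one]
    _ = (y : ℂ) ^ ((1 : ℂ) + 2 * (s / 2 - 1)) := (cpow_add _ _ hy0).symm
    _ = (y : ℂ) ^ (s - 1) := by congr 1; ring

/-- The Gaussian Mellin moment: `∫_{(0,∞)} y^{s−1} e^{−y²/2} dy = 2^{s/2 − 1} Γ(s/2)` for `Re s > 0`. -/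
theorem mellin_gaussian {s : ℂ} (hs : 0 < s.re) :
    ∫ y in Ioi (0 : ℝ), (y : ℂ) ^ (s - 1) * Complex.exp (-(y : ℂ) ^ 2 / 2) =
      (2 : ℂ) ^ (s / 2 - 1) * Complex.Gamma (s / 2) := by
  -- the substitution `t = y²`
  have hsub := integral_comp_rpow_Ioi_of_pos
    (g := fun t : ℝ => (1 / 2 : ℂ) * ((t : ℂ) ^ (s / 2 - 1) * Complex.exp (-((1 / 2 : ℝ) * (t : ℂ))))) two_pos
  have hL : (∫ x in Ioi (0 : ℝ), ((2 : ℝ) * x ^ ((2 : ℝ) - 1)) •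
      ((1 / 2 : ℂ) * ((((x ^ (2 : ℝ) : ℝ) : ℂ)) ^ (s / 2 - 1) *
        Complex.exp (-((1 / 2 : ℝ) * (((x ^ (2 : ℝ) : ℝ) : ℂ))))))) =
      ∫ y in Ioi (0 : ℝ), (y : ℂ) ^ (s - 1) * Complex.exp (-(y : ℂ) ^ 2 / 2) := by
    refine setIntegral_congr_fun measurableSet_Ioi (fun x hx => ?_)
    have hx : 0 < x := hx
    have hx2 : (((x ^ (2 : ℝ) : ℝ) : ℂ)) = (x : ℂ) ^ 2 := by
      rw [Real.rpow_two]; push_cast; rfl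
    rw [show (2 : ℝ) - 1 = 1 by norm_num, Real.rpow_one, real_smul, ← ofReal_mul_sq_cpow hx s, hx2]
    push_cast
    ring_nf
  rw [← hL, hsub]
  -- the `t`-integral is a Gamma integral
  have hG := integral_cpow_mul_exp_neg_mul_Ioi (a := s / 2) (r := 1 / 2)
    (by simpa using (half_pos hs)) one_half_pos
  rw [integral_const_mul]
  have hG' : (∫ t in Ioi (0 : ℝ), (t : ℂ) ^ (s / 2 - 1) * Complex.exp (-((1 / 2 : ℝ) * (t : ℂ)))) =
      (1 / (1 / 2 : ℝ) : ℂ) ^ (s / 2) * Complex.Gamma (s / 2) := by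
    rw [← hG]
  rw [hG']
  have h22 : (1 / (1 / 2 : ℝ) : ℂ) = 2 := by norm_num
  rw [h22, cpow_sub _ _ two_ne_zero, cpow_one]
  ring

/-- Integrability of the monomial-Gaussian Mellin integrand on `(0, ∞)`. -/
theorem integrableOn_mellin_gaussian_mul_pow {s : ℂ} (hs : 0 < s.re) (k : ℕ) :
    IntegrableOn (fun y : ℝ => (y : ℂ) ^ (s - 1) * (y : ℂ) ^ (2 * k) * Complex.exp (-(y : ℂ) ^ 2 / 2))
      (Ioi 0) := by
  have hb : IntegrableOn (fun y : ℝ => y ^ (s.re - 1 + 2 * k) * Real.exp (-(1 / 2) * y ^ 2)) (Ioi 0) :=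
    integrableOn_rpow_mul_exp_neg_mul_sq one_half_pos (by linarith [show (0:ℝ) ≤ 2 * (k : ℝ) by positivity])
  refine Integrable.mono' hb ?_ ?_
  · refine ContinuousOn.aestronglyMeasurable ?_ measurableSet_Ioi
    refine continuousOn_of_forall_continuousAt (fun y hy => ?_)
    have hy : 0 < y := hy
    have h1 : ContinuousAt (fun a : ℝ => (a : ℂ) ^ (s - 1)) y :=
      continuousAt_ofReal_cpow_const y (s - 1) (Or.inr hy.ne')
    have h2 : ContinuousAt (fun a : ℝ => (a : ℂ) ^ (2 * k) * Complex.exp (-(a : ℂ) ^ 2 / 2)) y := by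
      fun_prop
    exact (h1.mul h2).congr (Filter.Eventually.of_forall fun a => by simp only [Pi.mul_apply, mul_assoc])
  · refine (ae_restrict_iff' measurableSet_Ioi).mpr (ae_of_all _ (fun y hy => ?_))
    have hy : 0 < y := hy
    have hexp : Complex.exp (-(y : ℂ) ^ 2 / 2) = ((Real.exp (-(1 / 2) * y ^ 2) : ℝ) : ℂ) := by
      rw [ofReal_exp]; push_cast; ring_nf
    rw [hexp, norm_mul, norm_mul, norm_real, Real.norm_eq_abs, abs_of_pos (Real.exp_pos _),
      norm_cpow_eq_rpow_re_of_pos hy, norm_pow, norm_real, Real.norm_eq_abs, abs_of_pos hy,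
      sub_re, one_re, Real.rpow_add hy, show (2 * (k : ℝ)) = ((2 * k : ℕ) : ℝ) by push_cast; ring,
      Real.rpow_natCast]

/-- `∫_{(0,∞)} y^{s−1} y^{2k} e^{−y²/2} dy = 2^{(s+2k)/2 − 1} Γ((s+2k)/2)` for `Re s > 0`. -/
theorem mellin_gaussian_mul_pow {s : ℂ} (hs : 0 < s.re) (k : ℕ) :
    ∫ y in Ioi (0 : ℝ), (y : ℂ) ^ (s - 1) * (y : ℂ) ^ (2 * k) * Complex.exp (-(y : ℂ) ^ 2 / 2) =
      (2 : ℂ) ^ ((s + 2 * k) / 2 - 1) * Complex.Gamma ((s + 2 * k) / 2) := by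
  have hs' : 0 < (s + 2 * k).re := by simp; positivity
  rw [← mellin_gaussian hs']
  refine setIntegral_congr_fun measurableSet_Ioi (fun y hy => ?_)
  have hy : 0 < y := hy
  have hy0 : (y : ℂ) ≠ 0 := ofReal_ne_zero.mpr hy.ne'
  rw [show s + 2 * (k : ℂ) - 1 = (s - 1) + (2 * k : ℕ) by push_cast; ring, cpow_add _ _ hy0, cpow_natCast]

/-- A convenient packaging: `Γ((s+2)/2) = (s/2) Γ(s/2)` etc. -/
theorem Gamma_half_add_one {s : ℂ} (hs : s ≠ 0) :
    Complex.Gamma ((s + 2) / 2) = s / 2 * Complex.Gamma (s / 2) := by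
  rw [show (s + 2) / 2 = s / 2 + 1 by ring, Complex.Gamma_add_one _ (by simpa using hs)]

/-- **The even seed's Mellin transform.**  `∫_{(0,∞)} y^{s−1}(y⁴ − 3y²)e^{−y²/2} dy = 2^{s/2−1}Γ(s/2)·s(s−1)`
(`Re s > 0`): the pole-killed Hermite combination `h₄ − √(3/8)h₀ ∝ y²(y² − 3)e^{−y²/2}` has a Mellin transform
divisible by `s(s − 1)` — it vanishes at `ζ`'s pole `s = 1` (zero mass) and at `s = 0` (zero value at the origin). -/
theorem hermiteSeedEven_mellin {s : ℂ} (hs : 0 < s.re) :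
    ∫ y in Ioi (0 : ℝ), (y : ℂ) ^ (s - 1) * ((y : ℂ) ^ 4 - 3 * (y : ℂ) ^ 2) * Complex.exp (-(y : ℂ) ^ 2 / 2) =
      (2 : ℂ) ^ (s / 2 - 1) * Complex.Gamma (s / 2) * (s * (s - 1)) := by
  have hs0 : s ≠ 0 := fun h => by simp [h] at hs
  have h2 := mellin_gaussian_mul_pow hs 2
  have h1 := mellin_gaussian_mul_pow hs 1
  have i2 := integrableOn_mellin_gaussian_mul_pow hs 2
  have i1 := integrableOn_mellin_gaussian_mul_pow hs 1
  have hsplit : (fun y : ℝ => (y : ℂ) ^ (s - 1) * ((y : ℂ) ^ 4 - 3 * (y : ℂ) ^ 2) * Complex.exp (-(y : ℂ) ^ 2 / 2))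
      = fun y : ℝ => ((y : ℂ) ^ (s - 1) * (y : ℂ) ^ (2 * 2) * Complex.exp (-(y : ℂ) ^ 2 / 2))
        - 3 * ((y : ℂ) ^ (s - 1) * (y : ℂ) ^ (2 * 1) * Complex.exp (-(y : ℂ) ^ 2 / 2)) := by
    funext y; ring_nf
  rw [hsplit, integral_sub i2 (i1.const_mul 3), integral_const_mul, h2, h1]
  -- Gamma recursion
  have hG4 : Complex.Gamma ((s + 2 * (2 : ℕ)) / 2) = (s + 2) / 2 * (s / 2) * Complex.Gamma (s / 2) := by
    rw [show (s + 2 * ((2 : ℕ) : ℂ)) / 2 = (s + 2) / 2 + 1 by push_cast; ring,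
      Complex.Gamma_add_one _ (by
        intro h; have := congrArg Complex.re h; simp at this; linarith), Gamma_half_add_one hs0]
    ring
  have hG2 : Complex.Gamma ((s + 2 * (1 : ℕ)) / 2) = s / 2 * Complex.Gamma (s / 2) := by
    rw [show (s + 2 * ((1 : ℕ) : ℂ)) / 2 = (s + 2) / 2 by push_cast; ring, Gamma_half_add_one hs0]
  have hP4 : (2 : ℂ) ^ ((s + 2 * (2 : ℕ)) / 2 - 1) = (2 : ℂ) ^ (s / 2 - 1) * 4 := by
    rw [show (s + 2 * ((2 : ℕ) : ℂ)) / 2 - 1 = (s / 2 - 1) + (2 : ℕ) by push_cast; ring,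
      cpow_add _ _ two_ne_zero, cpow_natCast]
    norm_num
  have hP2 : (2 : ℂ) ^ ((s + 2 * (1 : ℕ)) / 2 - 1) = (2 : ℂ) ^ (s / 2 - 1) * 2 := by
    rw [show (s + 2 * ((1 : ℕ) : ℂ)) / 2 - 1 = (s / 2 - 1) + (1 : ℕ) by push_cast; ring,
      cpow_add _ _ two_ne_zero, cpow_natCast]
    norm_num
  rw [hG4, hG2, hP4, hP2]
  ring

/-- **The odd seed's Mellin transform.**  `∫_{(0,∞)} y^{s−1}(y⁶ − (15/2)y⁴ + (15/2)y²)e^{−y²/2} dy =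
2^{s/2−1}Γ(s/2)·s(s−1)(s − 1/2)` (`Re s > 0`): the pole-killed combination `h₆ − √(5/8)h₂` has the extra factor
`s − 1/2`, odd under `s ↦ 1 − s`. -/
theorem hermiteSeedOdd_mellin {s : ℂ} (hs : 0 < s.re) :
    ∫ y in Ioi (0 : ℝ), (y : ℂ) ^ (s - 1) * ((y : ℂ) ^ 6 - 15 / 2 * (y : ℂ) ^ 4 + 15 / 2 * (y : ℂ) ^ 2) *
        Complex.exp (-(y : ℂ) ^ 2 / 2) =
      (2 : ℂ) ^ (s / 2 - 1) * Complex.Gamma (s / 2) * (s * (s - 1) * (s - 1 / 2)) := by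
  have hs0 : s ≠ 0 := fun h => by simp [h] at hs
  have h3 := mellin_gaussian_mul_pow hs 3
  have h2 := mellin_gaussian_mul_pow hs 2
  have h1 := mellin_gaussian_mul_pow hs 1
  have i3 := integrableOn_mellin_gaussian_mul_pow hs 3
  have i2 := integrableOn_mellin_gaussian_mul_pow hs 2
  have i1 := integrableOn_mellin_gaussian_mul_pow hs 1
  have hsplit : (fun y : ℝ => (y : ℂ) ^ (s - 1) * ((y : ℂ) ^ 6 - 15 / 2 * (y : ℂ) ^ 4 + 15 / 2 * (y : ℂ) ^ 2) *
        Complex.exp (-(y : ℂ) ^ 2 / 2))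
      = fun y : ℝ => (((y : ℂ) ^ (s - 1) * (y : ℂ) ^ (2 * 3) * Complex.exp (-(y : ℂ) ^ 2 / 2))
        - 15 / 2 * ((y : ℂ) ^ (s - 1) * (y : ℂ) ^ (2 * 2) * Complex.exp (-(y : ℂ) ^ 2 / 2)))
        + 15 / 2 * ((y : ℂ) ^ (s - 1) * (y : ℂ) ^ (2 * 1) * Complex.exp (-(y : ℂ) ^ 2 / 2)) := by
    funext y; ring_nf
  have i32 : Integrable (fun y : ℝ => (y : ℂ) ^ (s - 1) * (y : ℂ) ^ (2 * 3) * Complex.exp (-(y : ℂ) ^ 2 / 2)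
      - 15 / 2 * ((y : ℂ) ^ (s - 1) * (y : ℂ) ^ (2 * 2) * Complex.exp (-(y : ℂ) ^ 2 / 2)))
      (volume.restrict (Ioi 0)) := i3.sub (i2.const_mul _)
  rw [hsplit, integral_add i32 (i1.const_mul _), integral_sub i3 (i2.const_mul _),
    integral_const_mul, integral_const_mul, h3, h2, h1]
  have hne : ∀ r : ℝ, 0 ≤ r → s / 2 + r ≠ 0 := by
    intro r hr h; have := congrArg Complex.re h; simp at this; linarith
  have hG6 : Complex.Gamma ((s + 2 * (3 : ℕ)) / 2) = (s + 4) / 2 * ((s + 2) / 2) * (s / 2) * Complex.Gamma (s / 2) := by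
    rw [show (s + 2 * ((3 : ℕ) : ℂ)) / 2 = (s / 2 + 2) + 1 by push_cast; ring,
      Complex.Gamma_add_one _ (by simpa using hne 2 (by norm_num)),
      show s / 2 + 2 = (s / 2 + 1) + 1 by ring, Complex.Gamma_add_one _ (by simpa using hne 1 (by norm_num)),
      Complex.Gamma_add_one _ (by simpa using hs0)]
    ring
  have hG4 : Complex.Gamma ((s + 2 * (2 : ℕ)) / 2) = (s + 2) / 2 * (s / 2) * Complex.Gamma (s / 2) := by
    rw [show (s + 2 * ((2 : ℕ) : ℂ)) / 2 = (s / 2 + 1) + 1 by push_cast; ring,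
      Complex.Gamma_add_one _ (by simpa using hne 1 (by norm_num)), Complex.Gamma_add_one _ (by simpa using hs0)]
    ring
  have hG2 : Complex.Gamma ((s + 2 * (1 : ℕ)) / 2) = s / 2 * Complex.Gamma (s / 2) := by
    rw [show (s + 2 * ((1 : ℕ) : ℂ)) / 2 = s / 2 + 1 by push_cast; ring, Complex.Gamma_add_one _ (by simpa using hs0)]
  have hP : ∀ k : ℕ, (2 : ℂ) ^ ((s + 2 * (k : ℕ)) / 2 - 1) = (2 : ℂ) ^ (s / 2 - 1) * 2 ^ k := by
    intro k
    rw [show (s + 2 * ((k : ℕ) : ℂ)) / 2 - 1 = (s / 2 - 1) + (k : ℕ) by ring,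
      cpow_add _ _ two_ne_zero, cpow_natCast]
  rw [hG6, hG4, hG2, hP 3, hP 2, hP 1]
  ring

/-- **`ζ` times the even seed's Mellin transform is Riemann's `ξ`.**  For `Re s > 0`, `s ≠ 1`:
`ζ(s) · 2^{s/2−1}Γ(s/2)s(s−1) = (2π)^{s/2} ξ(s)` (`ξ(s) = ½s(s−1)π^{−s/2}Γ(s/2)ζ(s)` = `Literature…riemannXi`).
So the transform of the transported even seed, `e^{sa}ζ(s)M_{h_e}(s)`, is `κ_e e^{sa}(2π)^{s/2}ξ(s)` — Connes' Fact 6.2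
(arXiv:2602.04022) in Mellin coordinates. -/
theorem zeta_mul_evenFactor {s : ℂ} (hs : 0 < s.re) (hs1 : s ≠ 1) :
    riemannZeta s * ((2 : ℂ) ^ (s / 2 - 1) * Complex.Gamma (s / 2) * (s * (s - 1))) =
      (2 * π : ℂ) ^ (s / 2) * Literature.NumberTheory.LFunctions.riemannXi s := by
  have hs0 : s ≠ 0 := fun h => by simp [h] at hs
  have hΓ : Complex.Gamma (s / 2) ≠ 0 := Complex.Gamma_ne_zero_of_re_pos (by simpa using half_pos hs)
  have hpi0 : (π : ℂ) ≠ 0 := ofReal_ne_zero.mpr pi_ne_zero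
  have hpi : (π : ℂ) ^ (s / 2) ≠ 0 := by
    rw [cpow_def_of_ne_zero hpi0]; exact Complex.exp_ne_zero _
  have hneg : (π : ℂ) ^ (-s / 2) = ((π : ℂ) ^ (s / 2))⁻¹ := by
    rw [show -s / 2 = -(s / 2) by ring, cpow_neg]
  have h2pi : (2 * π : ℂ) ^ (s / 2) = (2 : ℂ) ^ (s / 2) * (π : ℂ) ^ (s / 2) := by
    have := mul_cpow_ofReal_nonneg (zero_le_two) pi_pos.le (s / 2)
    push_cast at this
    exact this
  have h2 : (2 : ℂ) ^ (s / 2) = (2 : ℂ) ^ (s / 2 - 1) * 2 := by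
    rw [cpow_sub _ _ two_ne_zero, cpow_one]; field_simp
  rw [Literature.NumberTheory.LFunctions.riemannXi_eq_mul_completedRiemannZeta hs0 hs1,
    riemannZeta_def_of_ne_zero hs0, Gammaℝ_def, hneg, h2pi, h2]
  field_simp

/-- The odd twin: `ζ(s) · 2^{s/2−1}Γ(s/2)s(s−1)(s − 1/2) = (2π)^{s/2} ξ(s) (s − 1/2)`. -/
theorem zeta_mul_oddFactor {s : ℂ} (hs : 0 < s.re) (hs1 : s ≠ 1) :
    riemannZeta s * ((2 : ℂ) ^ (s / 2 - 1) * Complex.Gamma (s / 2) * (s * (s - 1) * (s - 1 / 2))) =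
      (2 * π : ℂ) ^ (s / 2) * Literature.NumberTheory.LFunctions.riemannXi s * (s - 1 / 2) := by
  rw [← zeta_mul_evenFactor hs hs1]
  ring

/-- **On the critical line.**  For `s = 1/2 + iγ`: `‖ζ(s)·2^{s/2−1}Γ(s/2)s(s−1)‖ = (2π)^{1/4}·‖Ξ(γ)‖` with
`Ξ(γ) = ξ(1/2 + iγ)` (`Literature…riemannXiUpper`).  Squared and integrated (Mellin–Plancherel), this is WEIL5-KAPPA §1:
the transport Gram norm of the even Hermite seed is `(κ_e²/√(2π))∫Ξ²`. -/
theorem norm_zeta_mul_evenFactor_critical (γ : ℝ) :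
    ‖riemannZeta (1 / 2 + I * γ) * ((2 : ℂ) ^ ((1 / 2 + I * γ) / 2 - 1) * Complex.Gamma ((1 / 2 + I * γ) / 2) *
        ((1 / 2 + I * γ) * ((1 / 2 + I * γ) - 1)))‖ =
      (2 * π) ^ (1 / 4 : ℝ) * ‖Literature.NumberTheory.LFunctions.riemannXiUpper γ‖ := by
  have hs : 0 < (1 / 2 + I * (γ : ℂ)).re := by simp
  have hs1 : (1 / 2 + I * (γ : ℂ)) ≠ 1 := by
    intro h; have := congrArg Complex.re h; simp at this
  rw [zeta_mul_evenFactor hs hs1, norm_mul, Literature.NumberTheory.LFunctions.riemannXiUpper]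
  congr 1
  have h2pi : (2 * π : ℂ) = ((2 * π : ℝ) : ℂ) := by push_cast; rfl
  rw [h2pi, norm_cpow_eq_rpow_re_of_pos (by positivity)]
  congr 1
  simp
  norm_num

/-- The odd twin on the critical line: `‖ζ(s)·M_o-factor‖ = (2π)^{1/4}·|γ|·‖Ξ(γ)‖` (`|s − 1/2| = |γ|`), whence
`‖𝓔h_o‖² ∝ ∫t²Ξ(t)²dt`. -/
theorem norm_zeta_mul_oddFactor_critical (γ : ℝ) :
    ‖riemannZeta (1 / 2 + I * γ) * ((2 : ℂ) ^ ((1 / 2 + I * γ) / 2 - 1) * Complex.Gamma ((1 / 2 + I * γ) / 2) *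
        ((1 / 2 + I * γ) * ((1 / 2 + I * γ) - 1) * ((1 / 2 + I * γ) - 1 / 2)))‖ =
      (2 * π) ^ (1 / 4 : ℝ) * |γ| * ‖Literature.NumberTheory.LFunctions.riemannXiUpper γ‖ := by
  have hs : 0 < (1 / 2 + I * (γ : ℂ)).re := by simp
  have hs1 : (1 / 2 + I * (γ : ℂ)) ≠ 1 := by
    intro h; have := congrArg Complex.re h; simp at this
  rw [zeta_mul_oddFactor hs hs1, norm_mul, ← zeta_mul_evenFactor hs hs1, norm_zeta_mul_evenFactor_critical γ]
  have : (1 / 2 + I * (γ : ℂ)) - 1 / 2 = I * γ := by ring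
  rw [this, norm_mul, norm_I, one_mul, norm_real, Real.norm_eq_abs]
  ring

end Summit.RiemannHypothesis.RiemannHypothesis.Theorems.WeilHermiteSeedMellin

end
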